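import Literature.Analysis.FluidPDE.ExtremeGrowthBounds
import Literature.Analysis.FunctionSpaces.TorusClassicalNSGluing
import Mathlib.Order.Filter.AtTopBot.Basic
import HarnessLib

/-!
# The necessary enstrophy blow-up rate (Leray-type lower bound) from the Lu–Doering estimate

Analysis/FluidPDE file, companion of `ExtremeGrowthBounds.lean`: the "what growth a singularity
would NEED" side of the extreme-enstrophy-growth programme (Lu–Doering 2008; Ayala–Protas 2017,
§2; Kang–Yun–Protas 2020, §2 and §5), PROVED from the single named fact
`LuDoering2008_enstrophyRate_le` (`dℰ/dt ≤ C_LD ℰ³`, `C_LD = 27/(8π⁴ν³)`).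

Integrating `dℰ/dt ≤ C_LD ℰ³` BACKWARDS from a blow-up time: if a zero-mean classical solution of
unforced Navier–Stokes on the unit 3-torus lives on `[a, T)` and its enstrophy is unbounded as
`t ↑ T`, then at every earlier time

`2 C_LD ℰ(u(t))² (T − t) ≥ 1`, i.e. `ℰ(u(t)) ≥ 1/√(2 C_LD (T − t)) = √(4π⁴ν³/27) (T − t)^{-1/2}`,

equivalently `T − t ≥ t₀(ℰ(u(t))) = luDoeringBlowupTime ν (ℰ(u(t)))`: the remaining lifetime is at
least the blow-up time of the Lu–Doering majorant started from the current enstrophy (this is the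
enstrophy form of Leray's 1934 lower bound `‖∇u(t)‖₂ ≥ c ν^{3/4} (T − t)^{-1/4}`; Robinson–Rodrigo–
Sadowski 2016, Cor. 6.? / Lemma 6.?; Ayala–Protas 2017, discussion after (2.8); Kang–Yun–Protas
2020, §5: the optimal windows are "8–10 orders of magnitude" longer than `t₀`).

* `one_le_of_not_bddAbove_of_hasDerivWithinAt_le_cube` — the real-variable lemma: `f > 0` with
  `f' ≤ A f³` (one-sided derivatives within every `[a, b]`, `b < T`) and `f` unbounded on `[a, T)`
  force `1 ≤ 2A f(a)² (T − a)`;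
* `one_le_two_mul_luDoeringConst_mul_sq_mul` — the torus statement at every `t ∈ [a, T)`;
* `luDoeringBlowupTime_le_sub` — `t₀(ℰ(u t)) ≤ T − t`;
* `inv_sqrt_le_torusEnstrophy` — `1/√(2 C_LD (T − t)) ≤ ℰ(u t)`.

Blow-up is the HYPOTHESIS here (`¬ BddAbove` of the enstrophy on `[a, T)`, or `Tendsto … (𝓝[<] T)
atTop` in the primed versions); nothing in this file asserts that it happens. Deliberately NOT
here: the equivalence "loss of smoothness at `T` ⇔ enstrophy unbounded" (continuation criterion,
`TorusClassicalNSContinuation.lean` / `TorusClassicalNSEnstrophyLifespan.lean`), whole-space and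
`L^q` versions, Euler/BKM.
-/

noncomputable section

open MeasureTheory Set Function Filter Topology
open scoped InnerProductSpace RealInnerProductSpace

namespace Literature.Analysis.FluidPDE

open Literature.Analysis.FunctionSpaces

/-! ## Real-variable lemma -/

section Comparison

/-- **Backward integration of `y' ≤ A y³` from a blow-up time.** Let `a < T`, `f > 0` on `[a, T)`
with one-sided derivatives `f'` within every `[a, b]`, `a < b < T`, satisfying `f' ≤ A f³` on
`[a, T)`. If `f` is unbounded on `[a, T)` then `1 ≤ 2A f(a)² (T − a)` (otherwise the majorant
`f(a)/√(1 − 2A f(a)²(t − a))` of `le_div_sqrt_of_hasDerivWithinAt_le_cube` stays finite up to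
`t = T` and bounds `f`). [folklore] -/
theorem one_le_of_not_bddAbove_of_hasDerivWithinAt_le_cube {f f' : ℝ → ℝ} {a T A : ℝ}
    (haT : a < T)
    (hf : ∀ b, a < b → b < T → ∀ t ∈ Icc a b, HasDerivWithinAt f (f' t) (Icc a b) t)
    (hpos : ∀ t ∈ Ico a T, 0 < f t) (hle : ∀ t ∈ Ico a T, f' t ≤ A * f t ^ 3)
    (hunb : ¬ BddAbove (f '' Ico a T)) :
    1 ≤ 2 * A * f a ^ 2 * (T - a) := by
  by_contra hlt
  have hlt : 2 * A * f a ^ 2 * (T - a) < 1 := lt_of_not_ge hlt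
  apply hunb
  have ha : a ∈ Ico a T := left_mem_Ico.2 haT
  have hfa : 0 < f a := hpos a ha
  set c : ℝ := 2 * A * f a ^ 2 with hc
  set D : ℝ := 1 - c * (T - a) with hD
  have hD0 : 0 < D := by rw [hD]; linarith
  set m : ℝ := min 1 D with hm
  have hm0 : 0 < m := lt_min one_pos hD0
  have hm1 : m ≤ 1 := min_le_left _ _
  refine ⟨f a / Real.sqrt m, ?_⟩
  rintro y ⟨s, hs, rfl⟩
  -- the affine function `E(s) = 1 − c (s − a)` stays above `m` on `[a, T)`
  have hEs : m ≤ 1 - c * (s - a) := by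
    rcases le_or_gt 0 c with hc0 | hc0
    · have : c * (s - a) ≤ c * (T - a) := mul_le_mul_of_nonneg_left (by linarith [hs.2]) hc0
      calc m ≤ D := min_le_right _ _
        _ ≤ 1 - c * (s - a) := by rw [hD]; linarith
    · have : c * (s - a) ≤ 0 := mul_nonpos_of_nonpos_of_nonneg hc0.le (by linarith [hs.1])
      calc m ≤ 1 := hm1
        _ ≤ 1 - c * (s - a) := by linarith
  have hsqrt_m : 0 < Real.sqrt m := Real.sqrt_pos.2 hm0
  rcases eq_or_lt_of_le hs.1 with h | has
  · -- `s = a`: `f a ≤ f a / √m` since `√m ≤ 1`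
    subst h
    rw [le_div_iff₀ hsqrt_m]
    have : Real.sqrt m ≤ 1 := by
      calc Real.sqrt m ≤ Real.sqrt 1 := Real.sqrt_le_sqrt hm1
        _ = 1 := Real.sqrt_one
    nlinarith [hfa]
  · -- `a < s < T`: compare on `[a, s]`
    have hsmall : 2 * A * f a ^ 2 * (s - a) < 1 := by rw [← hc]; linarith
    have key := le_div_sqrt_of_hasDerivWithinAt_le_cube has (hf s has hs.2)
      (fun t ht => hpos t ⟨ht.1, lt_of_le_of_lt ht.2 hs.2⟩)
      (fun t ht => hle t ⟨ht.1, lt_of_le_of_lt ht.2 hs.2⟩) (right_mem_Icc.2 has.le) hsmall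
    have hE0 : 0 < 1 - 2 * A * f a ^ 2 * (s - a) := by linarith
    calc f s ≤ f a / Real.sqrt (1 - 2 * A * f a ^ 2 * (s - a)) := key
      _ ≤ f a / Real.sqrt m := by
        apply div_le_div_of_nonneg_left hfa.le hsqrt_m
        exact Real.sqrt_le_sqrt (by rw [← hc]; exact hEs)

/-- Unboundedness from divergence: if `f → +∞` as `t ↑ T` and `a < T`, then `f` is unbounded on
`[a, T)`. [folklore] -/
theorem not_bddAbove_image_Ico_of_tendsto_atTop {f : ℝ → ℝ} {a T : ℝ} (haT : a < T)
    (hlim : Tendsto f (𝓝[<] T) atTop) : ¬ BddAbove (f '' Ico a T) := by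
  rintro ⟨M, hM⟩
  have h1 : ∀ᶠ s in 𝓝[<] T, M + 1 ≤ f s := hlim.eventually (eventually_ge_atTop (M + 1))
  have h2 : ∀ᶠ s in 𝓝[<] T, s ∈ Ico a T := Ico_mem_nhdsLT haT
  obtain ⟨s, hs1, hs2⟩ := (h1.and h2).exists
  have : f s ≤ M := hM ⟨s, hs2, rfl⟩
  linarith

end Comparison

/-! ## The torus statements -/

section Torus

variable {d : Type*} [Fintype d] [DecidableEq d]

/-- **Necessary enstrophy blow-up rate (quadratic form), from the Lu–Doering estimate.** Under
`LuDoering2008_enstrophyRate_le`: let `(u, p)` be a zero-mean classical solution of unforced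
Navier–Stokes on `T³ × [a, T)` (`Fintype.card d = 3`, `ν > 0`) with positive enstrophy, whose
enstrophy is unbounded on `[a, T)`. Then at every `t ∈ [a, T)`,
`1 ≤ 2 C_LD(ν) ℰ(u(t))² (T − t)` with `2 C_LD = 27/(4π⁴ν³)` (Leray 1934-type lower bound in
enstrophy form; Ayala–Protas 2017, after eq. (2.8); Kang–Yun–Protas 2020, §5).
[cite: AyalaProtas2017, §2 after eq. (2.8)] -/
theorem one_le_two_mul_luDoeringConst_mul_sq_mul (hLD : LuDoering2008_enstrophyRate_le (d := d))
    (hd : Fintype.card d = 3) {ν a T : ℝ} (hν : 0 < ν)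
    {u : ℝ → UnitAddTorus d → EuclideanSpace ℝ d} {p : ℝ → UnitAddTorus d → ℝ}
    (h : Torus.IsClassicalNSSolutionOn (Ico a T) ν 0 u p)
    (hmean : ∀ t ∈ Ico a T, Torus.HasZeroMean (u t))
    (hpos : ∀ t ∈ Ico a T, 0 < torusEnstrophy (u t))
    (hunb : ¬ BddAbove ((fun t => torusEnstrophy (u t)) '' Ico a T)) {t : ℝ} (ht : t ∈ Ico a T) :
    1 ≤ 2 * luDoeringConst ν * torusEnstrophy (u t) ^ 2 * (T - t) := by
  -- the time-derivative formula of the enstrophy (independent of the window)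
  set F : ℝ → ℝ := fun s => -ν * (∫ x, ‖Torus.laplacian (u s) x‖ ^ 2) +
      ∫ x, ⟪Torus.convect (u s) (u s) x - (0 : ℝ → UnitAddTorus d → EuclideanSpace ℝ d) s x,
        Torus.laplacian (u s) x⟫ with hF
  have htT : t < T := ht.2
  -- restriction to `[t, b]`, `t < b < T`
  have hres : ∀ b, t < b → b < T → Torus.IsClassicalNSSolutionOn (Icc t b) ν 0 u p :=
    fun b htb hbT => h.mono (fun s hs => ⟨ht.1.trans hs.1, lt_of_le_of_lt hs.2 hbT⟩)
      (uniqueDiffOn_Icc htb)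
  have hder : ∀ b, t < b → b < T → ∀ s ∈ Icc t b,
      HasDerivWithinAt (fun r => torusEnstrophy (u r)) (F s) (Icc t b) s :=
    fun b htb hbT s hs => (hres b htb hbT).hasDerivWithinAt_half_gradNormSq htb hs
  have hle : ∀ s ∈ Ico t T, F s ≤ luDoeringConst ν * torusEnstrophy (u s) ^ 3 := by
    intro s hs
    -- use the window `[t, b]` with `b = (s + T)/2`
    set b : ℝ := (s + T) / 2 with hb
    have hsb : s < b := by rw [hb]; linarith [hs.2]
    have htb : t < b := lt_of_le_of_lt hs.1 hsb
    have hbT : b < T := by rw [hb]; linarith [hs.2]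
    have hsI : s ∈ Icc t b := ⟨hs.1, hsb.le⟩
    exact hLD hd hν htb (hres b htb hbT)
      (fun r hr => hmean r ⟨ht.1.trans hr.1, lt_of_le_of_lt hr.2 hbT⟩) s hsI (F s)
      (hder b htb hbT s hsI)
  have hunb' : ¬ BddAbove ((fun r => torusEnstrophy (u r)) '' Ico t T) := by
    intro hb
    apply hunb
    -- on `[a, t]` the enstrophy is continuous, hence bounded; glue with the bound on `[t, T)`
    obtain ⟨M, hM⟩ := hb
    rcases eq_or_lt_of_le ht.1 with h0 | hat
    · subst h0; exact ⟨M, hM⟩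
    · have hcont : ContinuousOn (fun r => torusEnstrophy (u r)) (Icc a t) := by
        have hres_at : Torus.IsClassicalNSSolutionOn (Icc a t) ν 0 u p :=
          h.mono (fun s hs => ⟨hs.1, lt_of_le_of_lt hs.2 htT⟩) (uniqueDiffOn_Icc hat)
        intro s hs
        exact ((hres_at.hasDerivWithinAt_half_gradNormSq hat hs).continuousWithinAt)
      obtain ⟨M', hM'⟩ := (isCompact_Icc.bddAbove_image hcont)
      refine ⟨max M M', ?_⟩
      rintro y ⟨s, hs, rfl⟩
      rcases le_or_gt t s with hts | hst
      · exact (hM ⟨s, ⟨hts, hs.2⟩, rfl⟩).trans (le_max_left _ _)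
      · exact (hM' ⟨s, ⟨hs.1, hst.le⟩, rfl⟩).trans (le_max_right _ _)
  exact one_le_of_not_bddAbove_of_hasDerivWithinAt_le_cube (f' := F) htT hder
    (fun s hs => hpos s ⟨ht.1.trans hs.1, hs.2⟩) hle hunb'

/-- **The remaining lifetime is at least the bound's blow-up time.** In the situation of
`one_le_two_mul_luDoeringConst_mul_sq_mul` (enstrophy unbounded on `[a, T)`), for every
`t ∈ [a, T)`: `luDoeringBlowupTime ν (ℰ(u t)) = 4π⁴ν³/(27 ℰ(u t)²) ≤ T − t` (Ayala–Protas 2017,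
after eq. (2.8); Kang–Yun–Protas 2020, §5). [cite: AyalaProtas2017, §2 after eq. (2.8)] -/
theorem luDoeringBlowupTime_le_sub (hLD : LuDoering2008_enstrophyRate_le (d := d))
    (hd : Fintype.card d = 3) {ν a T : ℝ} (hν : 0 < ν)
    {u : ℝ → UnitAddTorus d → EuclideanSpace ℝ d} {p : ℝ → UnitAddTorus d → ℝ}
    (h : Torus.IsClassicalNSSolutionOn (Ico a T) ν 0 u p)
    (hmean : ∀ t ∈ Ico a T, Torus.HasZeroMean (u t))
    (hpos : ∀ t ∈ Ico a T, 0 < torusEnstrophy (u t))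
    (hunb : ¬ BddAbove ((fun t => torusEnstrophy (u t)) '' Ico a T)) {t : ℝ} (ht : t ∈ Ico a T) :
    luDoeringBlowupTime ν (torusEnstrophy (u t)) ≤ T - t := by
  have h1 := one_le_two_mul_luDoeringConst_mul_sq_mul hLD hd hν h hmean hpos hunb ht
  have hC : 0 < luDoeringConst ν := luDoeringConst_pos hν
  have hE : 0 < torusEnstrophy (u t) := hpos t ht
  have hq : 0 < 2 * luDoeringConst ν * torusEnstrophy (u t) ^ 2 := by positivity
  unfold luDoeringBlowupTime
  rw [div_le_iff₀ hq]
  linarith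

/-- **Necessary enstrophy blow-up rate.** In the situation of
`one_le_two_mul_luDoeringConst_mul_sq_mul` (enstrophy unbounded on `[a, T)`), for every
`t ∈ [a, T)`: `1/√(2 C_LD(ν) (T − t)) ≤ ℰ(u(t))`, i.e. `ℰ(u(t)) ≥ √(4π⁴ν³/27) (T − t)^{-1/2}`
— the enstrophy form of Leray's lower bound on the blow-up rate (Leray 1934; Robinson–Rodrigo–
Sadowski 2016, Ch. 6; Ayala–Protas 2017, after eq. (2.8)). [cite: AyalaProtas2017, §2 after eq. (2.8)] -/
theorem inv_sqrt_le_torusEnstrophy (hLD : LuDoering2008_enstrophyRate_le (d := d))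
    (hd : Fintype.card d = 3) {ν a T : ℝ} (hν : 0 < ν)
    {u : ℝ → UnitAddTorus d → EuclideanSpace ℝ d} {p : ℝ → UnitAddTorus d → ℝ}
    (h : Torus.IsClassicalNSSolutionOn (Ico a T) ν 0 u p)
    (hmean : ∀ t ∈ Ico a T, Torus.HasZeroMean (u t))
    (hpos : ∀ t ∈ Ico a T, 0 < torusEnstrophy (u t))
    (hunb : ¬ BddAbove ((fun t => torusEnstrophy (u t)) '' Ico a T)) {t : ℝ} (ht : t ∈ Ico a T) :
    1 / Real.sqrt (2 * luDoeringConst ν * (T - t)) ≤ torusEnstrophy (u t) := by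
  have h1 := one_le_two_mul_luDoeringConst_mul_sq_mul hLD hd hν h hmean hpos hunb ht
  have hC : 0 < luDoeringConst ν := luDoeringConst_pos hν
  have hE : 0 < torusEnstrophy (u t) := hpos t ht
  have hTt : 0 < T - t := by linarith [ht.2]
  have hq : 0 < 2 * luDoeringConst ν * (T - t) := by positivity
  have hsq : 0 < Real.sqrt (2 * luDoeringConst ν * (T - t)) := Real.sqrt_pos.2 hq
  rw [div_le_iff₀ hsq]
  -- `1 ≤ ℰ √q` from `1 ≤ ℰ² q`
  have h2 : 1 ≤ (torusEnstrophy (u t) * Real.sqrt (2 * luDoeringConst ν * (T - t))) ^ 2 := by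
    rw [mul_pow, Real.sq_sqrt hq.le]
    nlinarith [h1]
  have h3 : 0 ≤ torusEnstrophy (u t) * Real.sqrt (2 * luDoeringConst ν * (T - t)) := by positivity
  nlinarith [h2, h3, sq_nonneg (torusEnstrophy (u t) * Real.sqrt (2 * luDoeringConst ν * (T - t)) - 1)]

/-- **Necessary blow-up rate, `Tendsto` form.** Same conclusion as `inv_sqrt_le_torusEnstrophy`
when the blow-up hypothesis is stated as `ℰ(u(t)) → +∞` for `t ↑ T`.
[cite: AyalaProtas2017, §2 after eq. (2.8)] -/
theorem inv_sqrt_le_torusEnstrophy_of_tendsto (hLD : LuDoering2008_enstrophyRate_le (d := d))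
    (hd : Fintype.card d = 3) {ν a T : ℝ} (hν : 0 < ν)
    {u : ℝ → UnitAddTorus d → EuclideanSpace ℝ d} {p : ℝ → UnitAddTorus d → ℝ}
    (h : Torus.IsClassicalNSSolutionOn (Ico a T) ν 0 u p)
    (hmean : ∀ t ∈ Ico a T, Torus.HasZeroMean (u t))
    (hpos : ∀ t ∈ Ico a T, 0 < torusEnstrophy (u t))
    (hlim : Tendsto (fun t => torusEnstrophy (u t)) (𝓝[<] T) atTop) {t : ℝ} (ht : t ∈ Ico a T) :
    1 / Real.sqrt (2 * luDoeringConst ν * (T - t)) ≤ torusEnstrophy (u t) :=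
  inv_sqrt_le_torusEnstrophy hLD hd hν h hmean hpos
    (not_bddAbove_image_Ico_of_tendsto_atTop (lt_of_le_of_lt ht.1 ht.2) hlim) ht

end Torus

end Literature.Analysis.FluidPDE

end
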